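import Summits.ABC.IUTFork.Repair.RHRound4TLinear
import Summits.ABC.IUTFork.Repair.RHRound4ConstraintRequirementsB
import HarnessLib

/-!
# R-H ROUND 4, census row O-13 (MEASURE LEVEL, «BOUNDED» clause) — the measure-level EXCHANGE-RATE floor R-LM made a kernel theorem BY NAME:
# `rlm_core` (crit-4's one-screen algebra), `measureExchangeRate` (R1 over the cell currency at k3 «rounding none», ε = 0), the pair-law marginal
# lemmas (R3), and the value-law direction face (R4) — PROOF-ONLY (0 `def`, 0 `Prop` fact, 0 instance, 0 notation)

abc-iut cell, rung LADDER-ABC:A2.RESCUE.H; seat abc-iut-rh4-typ-1 (GEN 1, R4-3 TYPER; KEY `wake/KEY-abc-iut-rh4-typ-1-R4O13-RLMFACE.md` d50c49b181b380c3, R-H census desk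
abc-iut-rh-lead g6 2026-08-27T17:29:47Z, director-abc g6, HUMAN D-0133 · D-0134 · D-0135). COUNT-NEUTRAL: O-13 stays «LIVE WITH DIGITS — BOUNDED» (desk R109); this file
makes the BOUND a kernel theorem by name — proof mass on an A2-instrument row, not progress toward abc.
SOURCES OF RECORD: (1) abc-iut-rh4-id-14's memo `plan/rescue/R-H/ROUND4/R4-R4IDEA-LABELMEAS-abc-iut-rh4-id-14.md` 61dc32badbe9769a §1 «R-LM» (a)(b)(c), §5 residual words
R1–R4; (2) critic of record abc-iut-rh4-crit-4, `ROUND4/IDEAS/crit-labelmeas-abc-iut-rh4-crit-4.md` ebc6929b74936019: §1 F-A engine audit (R-LM (a)(b) ARE the engine's objects —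
`meetsmax.py` 89bf96d1e84a5c32 `Datum.eval`: kept PLACE-POOLED `u_w·min(E_y[d], E_y[P])`, meets ⟺ zero deficit, `E = C/μ = 2l·H·E_y[j+1]/K`, `P_j = j·D + (j+1)·G + r_j`),
§1 F-B (0/782 violations of `G_close ≥ β(n)` on the MM tables of record), §1 F-D (kernel face `rlm_core`, crit-4's UNFILED scratch `RLMCore.lean` e2cf4dcf110b5239, farm
rc 0), §4 «WHAT rh4-typ-1 MUST TYPE»; (3) crit-4's scratch files as copied VERBATIM by their author to `HOME/abc-iut-rh4-crit-4/` (STATUS 17:34:45Z): `RLMCore.lean`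
e2cf4dcf110b5239 (59 l) = §A's four theorems and `PairLawMarginal.lean` 0d003c4739ddfdbf (31 l) = §C's first three, transcribed statement-and-proof character for
character (namespace and docstring tags adapted); crit-4 is second reader for faithful transcription. CURRENCY (BY NAME, nothing re-declared): label laws
`ν : LabelLaw n` (abc-iut-L5-t8 ★ p539557 §V4 B1: `ν : Fin n → ℝ`, `nonneg`, `total = 1`; `LabelLaw.uniform` = print's `1/l⋆`; `lawConstant l ν = 2l·E_ν[j+1]/(E_ν[j²]−1) =
C(ν,l)`; FENCE p488865); real places `Round4TLinear.Place = (e_w, m_q, D, G)` (TLINEAR ★ p545946 — its `exchangeRate` is the PLACE-level law of which R-LM is the MEASURE-level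
companion); the integer cell `ReqsideWeightLaws.Cell` (p534392 lane) for the k3 calibration. Labels `j = i + 1`, `i : Fin n`, `n = l⋆`.
WHAT IS PROVED (namespace `Summit.ABC.IUTFork.Repair.RH.R4MeasureExchangeRate`; details in the theorem docstrings):
* §A THE CORE (crit-4 verbatim): `beta_le_one`, `beta_mul_theta_le`, **`rlm_core`** `(n+1)²/(n(n+3))·(1 − s/(θD+G+s)) ≤ ((n+1)/(n+3)·D + G + s_u)/(θD + G + s)`,
  `theta_le`; then (this seat) its denominator-free `s = s_u = 0` instance `rlm_core_linear` (what §B consumes) and `beta_table` (`β(3) = 16/18`, `β(8) = 81/88`,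
  `β(53) = 2916/2968`, memo §1 (e)).
* §B R1 **`measureExchangeRate`** at ε = 0 (REQB-SPEC k3 «rounding none»: margins `j·D_w + (j+1)·G_w − (j²−1)·m_q(w)`, no floor slack): `ν` with positive gap side
  (`ν ≠ δ₁`) MEETS @ 1 (`∀ w, Σ_i ν_i·margin(w,i) ≥ 0`), the uniform law FAILS at some place, `m_q > 0`, `D, G ≥ 0`, pooling weights `ũ ≥ 0` ⟹
  `(n+1)²·E(u;T) ≤ n(n+3)·E(ν;T)`, `E(u;T) = 2l·E_u[j+1]·H/K_u` the engine's DEFICIT-PRICED exponent (`H = Σ ũ_w m_q(w)`, `K_u` = demand − deficit, place-pooled;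
  `= C_u/μ_u` with `μ_u = K_u/((E_u[j²]−1)·H)`) and `E(ν;T) = lawConstant l ν` (`exponent_eq_lawConstant_of_meets`: a meeting law has zero deficit); `closingGain_ge_beta`
  (`G_close ≥ β(n)`). Architecture = memo §1: `exchangeRate_moments` — (b) the binding place is the argmin of the uniform price per unit height and `K_u ≥ r⋆·H`, (a) meeting
  there bounds `C(ν,l)` from below, (c) `rlm_core_linear` with `E_ν[j] ≤ n` (`law_first_le`); identities `slack_expand`, `law_slots_eq`, `uniform_first/slots/gap`
  (FENCE `sum_fin_labelSlots` / `sum_fin_sqSubOne`), `kept_eq_min` (engine dictionary). k3 CALIBRATION BY NAME: `cell_of_marginNone_nonneg` (= `cell_of_linear`),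
  `marginNone_gt_neg_of_cell` (= `linear_lt_of_cell`: the floor slack `r_j ∈ [0, e_w)` an ε(T)-version would carry — NOT typed here; ε = 0 first, per the KEY).
* §C R3, marginal half (crit-4 `PairLawMarginal.lean` verbatim, over `ℚ`): for a pair law `ν(i,j) = g(i·j⁻¹)` on a finite group (= a law of the difference class on an
  `𝔽_l^⋇`-torsor, [IUTchI] Prop. 4.9 (i)) `pairLaw_marginal_const`, `pairLaw_marginals_uniform` (both marginals `= Σ g`), `pairLaw_additive_value_uniform` («as WEIGHTS it
  is u again», memo §2 F4 (b)); plus the `G`-set form `invariantPairLaw_marginals_const` (any invariant `π`, any pretransitive action; this seat).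
* §D R4 in TLINEAR's value-law currency: `Estar_antitone_valueLaw` (raising `f` on `J` at fixed `pk, J, μ₀, l` LOWERS `E⋆`; memo R4 `uConst_antitone_valueLaw`).
NOT HERE: R1 with explicit ε(T); R2 `IncidenceLaw.…` (needs a NEW structure — a definition decision for the desk); the iff `PairLaw.invariant_iff_differenceClass`; any `def`.
HONEST FRAMING: an algebraic floor on OUR typed LP objects in OUR cell currency (the memo's (a)(b) = the engine's objects per crit-4 F-A), not a statement about print;
kernel-TRUE-as-typed ≠ proved-in-print; the measure-level relaxation (`ν ≠ 1/l⋆`) is UNLICENSED in the print reading ([IUTchIII] Rmk. 3.9.3 p. 119–120 = the tree's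
`Remark393_equalWeights`; M1, located) — KILLED-BY-CONSISTENCY there, unchanged; computed ≠ proved; located ≠ adjudicated; no Literature fact added (FROZEN FACT-LIST
f75a60bac22efdb6 untouched); no side on [IUTchI–IV] / SS2018 or any author (D-0045); nothing here asserts that abc is proved or refuted; A-PS is NOT abc.
[claim: Mochizuki2012, status: disputed] for every IUT locution.
[cite: Mochizuki2012, IUTchIII Prop. 3.9 (i) p. 116, Rmk. 3.9.3 p. 119–120, Cor. 3.12 p. 173–174; IUTchIV Prop. 1.4 p. 13, Thm. 1.10 Step (v)–(viii) p. 27–30;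
IUTchI Prop. 4.9 (i) p. 115, Prop. 6.8 (i) p. 168]
-/

noncomputable section

open Finset

namespace Summit.ABC.IUTFork.Repair.RH.R4MeasureExchangeRate

open Summit.ABC.IUTFork.Repair.RH.ReqsideWeightLaws Summit.ABC.IUTFork.Repair.RH.Round4TLinear
  Summit.ABC.IUTFork.Repair.RH.Round4ConstraintRequirements

/-! ## §A. The core — crit-4's `RLMCore.lean` e2cf4dcf110b5239 (`HOME/abc-iut-rh4-crit-4/`, namespace `RHCrit4.RLM` there) VERBATIM: statements and
proofs copied character for character (this namespace, docstrings tagged); author abc-iut-rh4-crit-4, farm rc 0 at 17:2xZ. «With `θ_u = (n+1)/(n+3)`,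
`β(n) = (n+1)²/(n(n+3))`, any `θ_ν ∈ (0, n/(n+1)]`, `D, G, s_ν, s_u ≥ 0`: `β(n)·(1 − s_ν/(θ_ν D + G + s_ν)) ≤ (θ_u D + G + s_u)/(θ_ν D + G + s_ν)`. This is the
one-screen algebra behind `G_close ≥ β(n)(1 − ε)`.» -/

/-- β(n) ≤ 1 for n ≥ 1. (crit-4 `RLMCore.lean`, verbatim) [folklore] -/
theorem beta_le_one (n : ℝ) (hn : 1 ≤ n) : (n+1)^2/(n*(n+3)) ≤ 1 := by
  have hpos : 0 < n*(n+3) := by positivity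
  rw [div_le_one hpos]; nlinarith

/-- β(n) · θ_ν ≤ θ_u whenever θ_ν ≤ n/(n+1). (crit-4 `RLMCore.lean`, verbatim) [folklore] -/
theorem beta_mul_theta_le (n θ : ℝ) (hn : 1 ≤ n) (hθ : θ ≤ n/(n+1)) :
    (n+1)^2/(n*(n+3)) * θ ≤ (n+1)/(n+3) := by
  have hn0 : 0 < n := by linarith
  have hn3 : 0 < n+3 := by linarith
  have hn1 : 0 < n+1 := by linarith
  calc (n+1)^2/(n*(n+3)) * θ ≤ (n+1)^2/(n*(n+3)) * (n/(n+1)) := by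
        apply mul_le_mul_of_nonneg_left hθ; positivity
    _ = (n+1)/(n+3) := by field_simp

/-- **R-LM (c), core inequality** — `A_ν(w)/A_u(w) ≥ β(n)·(1 − ε)` with `θ = θ_ν`, `s = s_ν(w)`, `su = s_u(w)` the rounding terms (memo §1 (a)(b)(c)).
(crit-4 `RLMCore.lean`, verbatim) [folklore] -/
theorem rlm_core (n θ D G s su : ℝ) (hn : 1 ≤ n) (hθ : θ ≤ n/(n+1))
    (hD : 0 ≤ D) (hG : 0 ≤ G) (hsu : 0 ≤ su) (hX : 0 < θ*D + G + s) :
    (n+1)^2/(n*(n+3)) * (1 - s/(θ*D + G + s)) ≤ ((n+1)/(n+3)*D + G + su)/(θ*D + G + s) := by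
  have hβ1 := beta_le_one n hn
  have hβθ := beta_mul_theta_le n θ hn hθ
  have hβ0 : 0 ≤ (n+1)^2/(n*(n+3)) := by
    have : 0 < n := by linarith
    positivity
  -- rewrite 1 - s/X = (θ D + G)/X
  have h1 : 1 - s/(θ*D + G + s) = (θ*D + G)/(θ*D + G + s) := by
    field_simp; ring
  rw [h1, ← mul_div_assoc]
  apply div_le_div_of_nonneg_right _ hX.le
  -- β (θ D + G) ≤ θ_u D + G + su
  have e1 : (n+1)^2/(n*(n+3)) * (θ*D + G) = ((n+1)^2/(n*(n+3)) * θ) * D + (n+1)^2/(n*(n+3)) * G := by ring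
  rw [e1]
  have t1 : ((n+1)^2/(n*(n+3)) * θ) * D ≤ (n+1)/(n+3) * D := mul_le_mul_of_nonneg_right hβθ hD
  have t2 : (n+1)^2/(n*(n+3)) * G ≤ G := by
    calc (n+1)^2/(n*(n+3)) * G ≤ 1 * G := mul_le_mul_of_nonneg_right hβ1 hG
      _ = G := one_mul G
  linarith

/-- θ_ν = 1 − 1/E[j+1] ≤ n/(n+1) when 1 ≤ E[j+1] ≤ n+1 (moment bound for a law on {1..n}; the law-level input `E_ν[j+1] = E_ν[j] + 1 ≤ n + 1` is
`law_slots_eq` / `law_first_le` of §B). (crit-4 `RLMCore.lean`, verbatim; `hn` is carried as printed) [folklore] -/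
theorem theta_le (n m : ℝ) (hn : 1 ≤ n) (hm1 : 1 ≤ m) (hm : m ≤ n+1) : 1 - 1/m ≤ n/(n+1) := by
  have hm0 : 0 < m := by linarith
  have hn1 : 0 < n+1 := by linarith
  have : 1 - 1/m = (m-1)/m := by field_simp
  rw [this, div_le_iff₀ hm0, div_mul_eq_mul_div, le_div_iff₀ hn1]; nlinarith

/-- **`rlm_core` at `s = s_u = 0`, denominators cleared** (`θ = Y/(Y+1)` with `Y = E_ν[j]`, `θ_u = ((n+1)/2)/((n+3)/2)`): for `0 ≤ Y ≤ n`, `D, G ≥ 0`,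
`(n+1)²·(n+3)/2·(Y·D + (Y+1)·G) ≤ n(n+3)·(Y+1)·((n+1)/2·D + (n+3)/2·G)` — the difference is `(n+3)/2·((n+1)(n−Y)·D + (n−1)(Y+1)·G) ≥ 0`. [folklore] -/
theorem rlm_core_linear (n Y D G : ℝ) (hn : 1 ≤ n) (hY0 : 0 ≤ Y) (hYn : Y ≤ n) (hD : 0 ≤ D) (hG : 0 ≤ G) :
    (n + 1) ^ 2 * ((n + 3) / 2) * (Y * D + (Y + 1) * G) ≤ n * (n + 3) * (Y + 1) * ((n + 1) / 2 * D + (n + 3) / 2 * G) := by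
  have h : n * (n + 3) * (Y + 1) * ((n + 1) / 2 * D + (n + 3) / 2 * G) - (n + 1) ^ 2 * ((n + 3) / 2) * (Y * D + (Y + 1) * G)
      = (n + 3) / 2 * ((n + 1) * (n - Y) * D + (n - 1) * (Y + 1) * G) := by ring
  have h1 : 0 ≤ (n + 1) * (n - Y) * D := mul_nonneg (mul_nonneg (by linarith) (by linarith)) hD
  have h2 : 0 ≤ (n - 1) * (Y + 1) * G := mul_nonneg (mul_nonneg (by linarith) (by linarith)) hG
  have h3 : 0 ≤ (n + 3) / 2 * ((n + 1) * (n - Y) * D + (n - 1) * (Y + 1) * G) := mul_nonneg (by linarith) (by linarith)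
  linarith

/-- The memo's table §1 (e), three rows exactly: `β(3) = 16/18` (`l = 7`), `β(8) = 81/88` (`l = 17`), `β(53) = 2916/2968` (`l = 107`). [folklore] -/
theorem beta_table : ((3 : ℝ) + 1) ^ 2 / (3 * (3 + 3)) = 16 / 18 ∧ ((8 : ℝ) + 1) ^ 2 / (8 * (8 + 3)) = 81 / 88 ∧
    ((53 : ℝ) + 1) ^ 2 / (53 * (53 + 3)) = 2916 / 2968 := by
  norm_num

/-! ## §B. R1 `measureExchangeRate` over the cell currency at k3 «rounding none» (ε = 0) -/

section Moments

variable {n : ℕ}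

/-- `E_ν[j+1] = E_ν[j] + 1` (total weight `1`). [folklore] -/
theorem law_slots_eq (L : LabelLaw n) :
    ∑ i, L.ν i * ((((i : ℕ) : ℝ) + 1) + 1) = (∑ i, L.ν i * (((i : ℕ) : ℝ) + 1)) + 1 := by
  simp only [mul_add, mul_one, Finset.sum_add_distrib, L.total]

/-- `E_ν[j] ≥ 0`. [folklore] -/
theorem law_first_nonneg (L : LabelLaw n) : 0 ≤ ∑ i, L.ν i * (((i : ℕ) : ℝ) + 1) :=
  Finset.sum_nonneg fun i _ => mul_nonneg (L.nonneg i) (by positivity)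

/-- `E_ν[j] ≤ n` (every label is `≤ n = l⋆`). [folklore] -/
theorem law_first_le (L : LabelLaw n) : ∑ i, L.ν i * (((i : ℕ) : ℝ) + 1) ≤ n := by
  calc ∑ i, L.ν i * (((i : ℕ) : ℝ) + 1) ≤ ∑ i, L.ν i * (n : ℝ) :=
        Finset.sum_le_sum fun i _ => mul_le_mul_of_nonneg_left (by exact_mod_cast Nat.succ_le_of_lt i.2) (L.nonneg i)
    _ = n := by rw [← Finset.sum_mul, L.total, one_mul]

/-- Uniform law, first moment: `E_u[j] = (n+1)/2` (`Σ_{j≤n} j = n(n+1)/2`, read off FENCE `sum_fin_labelSlots` minus `n`; the `Fin`-sum itself is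
abc-iut-E-t59's `TestATS4HullGain.sum_fin_val_add_one`, not imported to keep this file inside the R-H cone). [folklore] -/
theorem uniform_first (hn : 0 < n) : ∑ i, (LabelLaw.uniform hn).ν i * (((i : ℕ) : ℝ) + 1) = ((n : ℝ) + 1) / 2 := by
  have hs : ∑ i : Fin n, (((i : ℕ) : ℝ) + 1) = (n : ℝ) * (n + 1) / 2 := by
    have h := CellWeights.sum_fin_labelSlots n
    rw [Finset.sum_add_distrib, Finset.sum_const, Finset.card_univ, Fintype.card_fin, nsmul_eq_mul, mul_one] at h
    linarith
  simp only [LabelLaw.uniform_isUniform hn _]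
  rw [← Finset.mul_sum, hs]
  have : (n : ℝ) ≠ 0 := by exact_mod_cast hn.ne'
  field_simp

/-- Uniform law, slot count: `E_u[j+1] = (n+3)/2` (FENCE `sum_fin_labelSlots`). [folklore] -/
theorem uniform_slots (hn : 0 < n) : ∑ i, (LabelLaw.uniform hn).ν i * ((((i : ℕ) : ℝ) + 1) + 1) = ((n : ℝ) + 3) / 2 := by
  simp only [LabelLaw.uniform_isUniform hn _]
  rw [← Finset.mul_sum, CellWeights.sum_fin_labelSlots]
  have : (n : ℝ) ≠ 0 := by exact_mod_cast hn.ne'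
  field_simp

/-- Uniform law, gap side: `E_u[j²] − 1 = (n−1)(2n+5)/6` (FENCE `sum_fin_sqSubOne`, `S(n)/n`). [folklore] -/
theorem uniform_gap (hn : 0 < n) :
    ∑ i, (LabelLaw.uniform hn).ν i * ((((i : ℕ) : ℝ) + 1) ^ 2 - 1) = ((n : ℝ) - 1) * (2 * n + 5) / 6 := by
  simp only [LabelLaw.uniform_isUniform hn _]
  rw [← Finset.mul_sum, CellWeights.sum_fin_sqSubOne]
  have : (n : ℝ) ≠ 0 := by exact_mod_cast hn.ne'
  field_simp

/-- **Slack expansion** (linearity of the kept mass in the law, tst-2's «FACT USED»): the `y`-average of the rounding-none margins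
`j·D + (j+1)·G − (j²−1)·m_q` of a place is `E_y[j]·D + E_y[j+1]·G − (E_y[j²]−1)·m_q` — so «`y` meets at the place» reads `(E_y[j²]−1)·m_q ≤ E_y[j]·D + E_y[j+1]·G`
(memo §1 SETTING). [folklore] -/
theorem slack_expand (y : Fin n → ℝ) (mq D G : ℝ) :
    ∑ i, y i * ((((i : ℕ) : ℝ) + 1) * D + ((((i : ℕ) : ℝ) + 1) + 1) * G - (((((i : ℕ) : ℝ) + 1) ^ 2 - 1) * mq)) =
      (∑ i, y i * (((i : ℕ) : ℝ) + 1)) * D + (∑ i, y i * ((((i : ℕ) : ℝ) + 1) + 1)) * G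
        - (∑ i, y i * ((((i : ℕ) : ℝ) + 1) ^ 2 - 1)) * mq := by
  rw [Finset.sum_mul, Finset.sum_mul, Finset.sum_mul, ← Finset.sum_add_distrib, ← Finset.sum_sub_distrib]
  exact Finset.sum_congr rfl fun i _ => by ring

/-- **Engine dictionary** (crit-4 F-A: `K = M − deficit`, `deficit_w = max(0, −Σ_j y_j·margin_j(w))`, kept «place-pooled» `= min(E_y[d], E_y[P])`): with `P = d + slack`,
`d − max(0, −slack) = min(d, P)`. [folklore] -/
theorem kept_eq_min (d slack : ℝ) : d - max 0 (-slack) = min d (d + slack) := by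
  rcases le_total 0 slack with h | h
  · rw [max_eq_left (by linarith), min_eq_left (by linarith)]; ring
  · rw [max_eq_right (by linarith), min_eq_right (by linarith)]; ring

end Moments

/-- **R-LM AT THE MOMENT LEVEL** (memo §1 (a)(b)(c), `s = 0`; the law enters only through `Y = E_ν[j] ∈ [0, n]`, `E_ν[j+1] = Y + 1`, gap `g = E_ν[j²]−1 > 0`): places
`w ∈ s` with `m_q > 0`, `D, G ≥ 0`, weights `ũ ≥ 0`; `ν` meets everywhere (`g·m_q ≤ Y·D + (Y+1)·G`); the uniform law fails somewhere (`(n+1)/2·D + (n+3)/2·G <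
(n−1)(2n+5)/6·m_q`); `H = Σ ũ m_q`, `K_u = Σ ũ·min(E_u[d], E_u[P])`. Then `(n+1)²·(n+3)/2·H/K_u ≤ n(n+3)·(Y+1)/g` (× `2l`: `(n+1)²·E(u;T) ≤ n(n+3)·E(ν;T)`). [folklore] -/
theorem exchangeRate_moments {ι : Type*} (s : Finset ι) (mq D G ut : ι → ℝ) (n Y g H Ku : ℝ)
    (hn : 1 ≤ n) (hY0 : 0 ≤ Y) (hYn : Y ≤ n) (hg : 0 < g)
    (hut : ∀ w ∈ s, 0 ≤ ut w) (hmq : ∀ w ∈ s, 0 < mq w) (hD : ∀ w ∈ s, 0 ≤ D w) (hG : ∀ w ∈ s, 0 ≤ G w)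
    (hmeet : ∀ w ∈ s, g * mq w ≤ Y * D w + (Y + 1) * G w)
    (hfail : ∃ w ∈ s, (n + 1) / 2 * D w + (n + 3) / 2 * G w < (n - 1) * (2 * n + 5) / 6 * mq w)
    (hH : H = ∑ w ∈ s, ut w * mq w)
    (hKu : Ku = ∑ w ∈ s, ut w * min ((n - 1) * (2 * n + 5) / 6 * mq w) ((n + 1) / 2 * D w + (n + 3) / 2 * G w)) :
    (n + 1) ^ 2 * ((n + 3) / 2) * H / Ku ≤ n * (n + 3) * (Y + 1) / g := by
  obtain ⟨w₀, hw₀, hfail₀⟩ := hfail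
  -- (b) the binding place `b` = argmin over `s` of the uniform price per unit of local height; `r⋆ < E_u[j²]−1`, price at `b` > 0 (ν meets there), `K_u ≥ r⋆·H`
  obtain ⟨b, hb, hmin⟩ := s.exists_min_image (fun w => ((n + 1) / 2 * D w + (n + 3) / 2 * G w) / mq w) ⟨w₀, hw₀⟩
  have hrgu : ((n + 1) / 2 * D b + (n + 3) / 2 * G b) / mq b < (n - 1) * (2 * n + 5) / 6 := by
    have h1 : ((n + 1) / 2 * D b + (n + 3) / 2 * G b) / mq b ≤ ((n + 1) / 2 * D w₀ + (n + 3) / 2 * G w₀) / mq w₀ := hmin w₀ hw₀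
    exact h1.trans_lt (by rw [div_lt_iff₀ (hmq w₀ hw₀)]; exact hfail₀)
  have hPb : 0 < (n + 1) / 2 * D b + (n + 3) / 2 * G b := by
    have hpos : 0 < Y * D b + (Y + 1) * G b := lt_of_lt_of_le (mul_pos hg (hmq b hb)) (hmeet b hb)
    have p1 : Y * D b ≤ n * D b := mul_le_mul_of_nonneg_right hYn (hD b hb)
    have p2 : (Y + 1) * G b ≤ (n + 1) * G b := mul_le_mul_of_nonneg_right (by linarith) (hG b hb)
    nlinarith [hD b hb, hG b hb]
  have hr0 : 0 < ((n + 1) / 2 * D b + (n + 3) / 2 * G b) / mq b := div_pos hPb (hmq b hb)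
  have hterm : ∀ w ∈ s, ((n + 1) / 2 * D b + (n + 3) / 2 * G b) / mq b * mq w ≤
      min ((n - 1) * (2 * n + 5) / 6 * mq w) ((n + 1) / 2 * D w + (n + 3) / 2 * G w) := by
    intro w hw
    refine le_min (mul_le_mul_of_nonneg_right hrgu.le (hmq w hw).le) ?_
    have h1 : ((n + 1) / 2 * D b + (n + 3) / 2 * G b) / mq b ≤ ((n + 1) / 2 * D w + (n + 3) / 2 * G w) / mq w := hmin w hw
    rwa [le_div_iff₀ (hmq w hw)] at h1
  have hKu_ge : ((n + 1) / 2 * D b + (n + 3) / 2 * G b) / mq b * H ≤ Ku := by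
    rw [hH, hKu, Finset.mul_sum]
    refine Finset.sum_le_sum fun w hw => ?_
    calc ((n + 1) / 2 * D b + (n + 3) / 2 * G b) / mq b * (ut w * mq w)
        = ut w * (((n + 1) / 2 * D b + (n + 3) / 2 * G b) / mq b * mq w) := by ring
      _ ≤ ut w * min ((n - 1) * (2 * n + 5) / 6 * mq w) ((n + 1) / 2 * D w + (n + 3) / 2 * G w) :=
        mul_le_mul_of_nonneg_left (hterm w hw) (hut w hw)
  have hH0 : 0 ≤ H := by rw [hH]; exact Finset.sum_nonneg fun w hw => mul_nonneg (hut w hw) (hmq w hw).le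
  rcases hH0.eq_or_lt with hH0' | hHpos
  · rw [← hH0', mul_zero, zero_div]
    exact div_nonneg (mul_nonneg (mul_nonneg (by linarith) (by linarith)) (by linarith)) hg.le
  · have hKpos : 0 < Ku := lt_of_lt_of_le (mul_pos hr0 hHpos) hKu_ge
    have hc : 0 ≤ (n + 1) ^ 2 * ((n + 3) / 2) := mul_nonneg (sq_nonneg _) (by linarith)
    have step1 : (n + 1) ^ 2 * ((n + 3) / 2) * H / Ku ≤
        (n + 1) ^ 2 * ((n + 3) / 2) / (((n + 1) / 2 * D b + (n + 3) / 2 * G b) / mq b) := by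
      rw [div_le_div_iff₀ hKpos hr0]
      nlinarith [mul_le_mul_of_nonneg_left hKu_ge hc]
    have step2 : (n + 1) ^ 2 * ((n + 3) / 2) / (((n + 1) / 2 * D b + (n + 3) / 2 * G b) / mq b) ≤
        n * (n + 3) * (Y + 1) / g := by
      rw [div_div_eq_mul_div, div_le_div_iff₀ hPb hg]
      have hcore := rlm_core_linear n Y (D b) (G b) hn hY0 hYn (hD b hb) (hG b hb)
      have hm := hmeet b hb
      nlinarith [mul_le_mul_of_nonneg_left hm hc, mul_le_mul_of_nonneg_left hm (mul_nonneg hc (hmq b hb).le)]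
    exact step1.trans step2

section LawLevel

variable {n : ℕ}

/-- **R1 `measureExchangeRate` (ε = 0, k3 «rounding none»)**: labels `j = i+1 ≤ n = l⋆`, a label law `ν : LabelLaw n` (★ p539557) with positive gap side, places
`P w : Place` (★ p545946; `m_q > 0`, `D, G ≥ 0`) pooled with weights `ũ_w ≥ 0`, rounding-none margins `margin w i = j·D_w + (j+1)·G_w − (j²−1)·m_q(w)`. If `ν` MEETS @ 1
(`∀ w, 0 ≤ Σ_i ν_i·margin w i`) and the UNIFORM law FAILS at some place, then with `H = Σ_w ũ_w m_q(w)` and the engine's uniform kept mass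
`K_u = Σ_w ũ_w·((E_u[j²]−1)·m_q(w) − max(0, −Σ_i u_i·margin w i))` (demand minus deficit, place-pooled): `(n+1)²·(2l·E_u[j+1]·H/K_u) ≤ n(n+3)·lawConstant l ν`, i.e.
`(n+1)²·E(u;T) ≤ n(n+3)·E(ν;T)` — `G_close ≥ β(n)` (memo §1 (c); crit-4 F-B: 0/782 violations on the beds). About OUR typed objects; `ν ≠ 1/l⋆` is unlicensed in the
print reading (M1). [folklore] -/
theorem measureExchangeRate (hn : 0 < n) (L : LabelLaw n) {ι : Type*} (s : Finset ι) (P : ι → Place) (ut : ι → ℝ)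
    (margin : ι → Fin n → ℝ) (l : ℕ) (H Ku : ℝ)
    (hmargin : ∀ w i, margin w i =
      (((i : ℕ) : ℝ) + 1) * (P w).D + ((((i : ℕ) : ℝ) + 1) + 1) * (P w).G - ((((i : ℕ) : ℝ) + 1) ^ 2 - 1) * (P w).mq)
    (hut : ∀ w ∈ s, 0 ≤ ut w) (hmq : ∀ w ∈ s, 0 < (P w).mq) (hD : ∀ w ∈ s, 0 ≤ (P w).D) (hG : ∀ w ∈ s, 0 ≤ (P w).G)
    (hgap : 0 < ∑ i, L.ν i * ((((i : ℕ) : ℝ) + 1) ^ 2 - 1))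
    (hmeet : ∀ w ∈ s, 0 ≤ ∑ i, L.ν i * margin w i)
    (hfail : ∃ w ∈ s, ∑ i, (LabelLaw.uniform hn).ν i * margin w i < 0)
    (hH : H = ∑ w ∈ s, ut w * (P w).mq)
    (hKu : Ku = ∑ w ∈ s, ut w * ((∑ i, (LabelLaw.uniform hn).ν i * ((((i : ℕ) : ℝ) + 1) ^ 2 - 1)) * (P w).mq
      - max 0 (-(∑ i, (LabelLaw.uniform hn).ν i * margin w i)))) :
    ((n : ℝ) + 1) ^ 2 * (2 * (l : ℝ) * (∑ i, (LabelLaw.uniform hn).ν i * ((((i : ℕ) : ℝ) + 1) + 1)) * H / Ku) ≤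
      (n : ℝ) * (n + 3) * lawConstant l L := by
  have hsl : ∀ w, ∑ i, L.ν i * margin w i = (∑ i, L.ν i * (((i : ℕ) : ℝ) + 1)) * (P w).D
      + (∑ i, L.ν i * ((((i : ℕ) : ℝ) + 1) + 1)) * (P w).G - (∑ i, L.ν i * ((((i : ℕ) : ℝ) + 1) ^ 2 - 1)) * (P w).mq := by
    intro w; simp only [hmargin]; exact slack_expand L.ν (P w).mq (P w).D (P w).G
  have hsu : ∀ w, ∑ i, (LabelLaw.uniform hn).ν i * margin w i =
      ((n : ℝ) + 1) / 2 * (P w).D + ((n : ℝ) + 3) / 2 * (P w).G - ((n : ℝ) - 1) * (2 * n + 5) / 6 * (P w).mq := by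
    intro w; simp only [hmargin]; rw [slack_expand, uniform_first, uniform_slots, uniform_gap]
  have hmain := exchangeRate_moments s (fun w => (P w).mq) (fun w => (P w).D) (fun w => (P w).G) ut (n : ℝ)
    (∑ i, L.ν i * (((i : ℕ) : ℝ) + 1)) (∑ i, L.ν i * ((((i : ℕ) : ℝ) + 1) ^ 2 - 1)) H Ku
    (by exact_mod_cast hn) (law_first_nonneg L) (law_first_le L) hgap hut hmq hD hG
    (fun w hw => by have h := hmeet w hw; rw [hsl w, law_slots_eq] at h; linarith)
    (by obtain ⟨w, hw, h⟩ := hfail; exact ⟨w, hw, by rw [hsu w] at h; linarith⟩)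
    hH
    (by rw [hKu]; refine Finset.sum_congr rfl fun w _ => ?_; rw [uniform_gap, hsu w, kept_eq_min]; ring_nf)
  rw [uniform_slots]
  unfold lawConstant
  rw [law_slots_eq L]
  have h := mul_le_mul_of_nonneg_left hmain (by positivity : (0 : ℝ) ≤ 2 * (l : ℝ))
  calc ((n : ℝ) + 1) ^ 2 * (2 * (l : ℝ) * (((n : ℝ) + 3) / 2) * H / Ku) = 2 * (l : ℝ) * (((n : ℝ) + 1) ^ 2 * (((n : ℝ) + 3) / 2) * H / Ku) := by ring
    _ ≤ 2 * (l : ℝ) * ((n : ℝ) * (n + 3) * ((∑ i, L.ν i * (((i : ℕ) : ℝ) + 1)) + 1) / ∑ i, L.ν i * ((((i : ℕ) : ℝ) + 1) ^ 2 - 1)) := h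
    _ = (n : ℝ) * (n + 3) * (2 * (l : ℝ) * ((∑ i, L.ν i * (((i : ℕ) : ℝ) + 1)) + 1) / ∑ i, L.ν i * ((((i : ℕ) : ℝ) + 1) ^ 2 - 1)) := by ring

/-- **Ratio form: `G_close ≥ β(n)`** — whenever `(n+1)²·E(u;T) ≤ n(n+3)·E(ν;T)` with `E(u;T) > 0`, `β(n) = (n+1)²/(n(n+3)) ≤ E(ν;T)/E(u;T)`. [folklore] -/
theorem closingGain_ge_beta {n Eu Eν : ℝ} (hn : 1 ≤ n) (hEu : 0 < Eu) (h : (n + 1) ^ 2 * Eu ≤ n * (n + 3) * Eν) :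
    (n + 1) ^ 2 / (n * (n + 3)) ≤ Eν / Eu := by
  rw [div_le_div_iff₀ (by nlinarith) hEu]
  linarith

/-- **`E(ν;T) = C(ν,l)` for a meeting law** (crit-4 F-A «meets ⟺ zero deficit»; memo §1 `E(ν;T) = C(ν,l)/μ_ν(T)`, `μ_ν = 1` when `ν` meets): a meeting law's
deficit-priced kept mass `K_ν` is its whole demand `(E_ν[j²]−1)·H`, so the engine's exponent `2l·E_ν[j+1]·H/K_ν` equals `lawConstant l ν` (`H ≠ 0`) — the right side of
`measureExchangeRate` IS `n(n+3)·E(ν;T)`. [folklore] -/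
theorem exponent_eq_lawConstant_of_meets (L : LabelLaw n) {ι : Type*} (s : Finset ι) (P : ι → Place) (ut : ι → ℝ)
    (margin : ι → Fin n → ℝ) (l : ℕ) {H Kν : ℝ} (hmeet : ∀ w ∈ s, 0 ≤ ∑ i, L.ν i * margin w i)
    (hH : H = ∑ w ∈ s, ut w * (P w).mq) (hH0 : H ≠ 0)
    (hKν : Kν = ∑ w ∈ s, ut w * ((∑ i, L.ν i * ((((i : ℕ) : ℝ) + 1) ^ 2 - 1)) * (P w).mq - max 0 (-(∑ i, L.ν i * margin w i)))) :
    Kν = (∑ i, L.ν i * ((((i : ℕ) : ℝ) + 1) ^ 2 - 1)) * H ∧ 2 * (l : ℝ) * (∑ i, L.ν i * ((((i : ℕ) : ℝ) + 1) + 1)) * H / Kν = lawConstant l L := by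
  have hK : Kν = (∑ i, L.ν i * ((((i : ℕ) : ℝ) + 1) ^ 2 - 1)) * H := by
    rw [hKν, hH, Finset.mul_sum]
    refine Finset.sum_congr rfl fun w hw => ?_
    rw [max_eq_left (by linarith [hmeet w hw]), sub_zero]
    ring
  refine ⟨hK, ?_⟩
  unfold lawConstant
  rw [hK, mul_div_mul_right _ _ hH0]

/-- **k3 CALIBRATION TO THE INTEGER CELL, BY NAME** (`ReqsideWeightLaws.cell_of_linear`, p534392 lane): at an integer place `(e, m, δ, r_in, r_out)`, `e > 0`, a
non-negative rounding-none margin at label `j` licenses print's exact cell `Cell (j²) 1 e m δ r_in r_out j` (the floor slack `ρ_j ≥ 0` only helps). [folklore] -/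
theorem cell_of_marginNone_nonneg {e m δ rin rout : ℤ} (he : 0 < e) {j : ℕ}
    (h : 0 ≤ (j : ℤ) * δ + ((j : ℤ) + 1) * (rin - rout) - ((j : ℤ) ^ 2 - 1) * m) :
    Cell (fun j => (j : ℤ) ^ 2) 1 e m δ rin rout j := by
  refine cell_of_linear one_pos he ?_
  simp only [one_mul]
  linarith

/-- … and conversely a licensed cell has rounding-none margin `> −e_w` (`ReqsideWeightLaws.linear_lt_of_cell`) — the floor slack `r_j ∈ [0, e_w)` that the
ε(T)-version of R1 would carry (memo §1); not typed here. [folklore] -/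
theorem marginNone_gt_neg_of_cell {e m δ rin rout : ℤ} (he : 0 < e) {j : ℕ} (h : Cell (fun j => (j : ℤ) ^ 2) 1 e m δ rin rout j) :
    -e < (j : ℤ) * δ + ((j : ℤ) + 1) * (rin - rout) - ((j : ℤ) ^ 2 - 1) * m := by
  have h1 := linear_lt_of_cell one_pos he h
  simp only [one_mul] at h1
  linarith

end LawLevel

/-! ## §C. R3, marginal half — crit-4's `PairLawMarginal.lean` 0d003c4739ddfdbf VERBATIM (three lemmas over `ℚ`: a pair law `ν(i,j) = g(i·j⁻¹)` on a
finite group, i.e. a law of the DIFFERENCE CLASS on an `𝔽_l^⋇`-torsor, [IUTchI] Prop. 4.9 (i) / sheet V4 M2), plus the `G`-set form for any invariant pair law -/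

section PairLaw

/-- «A pair law `ν(i,j) = g(i·j⁻¹)` invariant under the simply-transitive diagonal action of a finite group has CONSTANT marginals:
`Σ_j g(a·j⁻¹) = Σ_h g(h)` for every `a`.» (crit-4 `PairLawMarginal.lean`, verbatim) [folklore] -/
theorem pairLaw_marginal_const {G : Type*} [Group G] [Fintype G] (g : G → ℚ) (a : G) :
    ∑ h, g (a * h⁻¹) = ∑ h, g h :=
  Fintype.sum_equiv ((Equiv.inv G).trans (Equiv.mulLeft a)) _ _ (fun _ => rfl)

/-- Two-sided version: for a pair law `ν(i,j) = g(i·j⁻¹)` both marginals are the constant `Σ g`. (crit-4 `PairLawMarginal.lean`, verbatim) [folklore] -/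
theorem pairLaw_marginals_uniform {G : Type*} [Group G] [Fintype G] (g : G → ℚ) (a : G) :
    (∑ j, g (a * j⁻¹) = ∑ h, g h) ∧ (∑ i, g (i * a⁻¹) = ∑ h, g h) :=
  ⟨pairLaw_marginal_const g a,
   Fintype.sum_equiv (Equiv.mulRight a⁻¹) _ _ (fun _ => rfl)⟩

/-- Additive value per label ⇒ the pair-averaged demand equals the UNIFORM-marginal demand:
`Σ_i Σ_j g(i j⁻¹)·(F i + F j) = (Σ g)·(Σ_i F i) + (Σ g)·(Σ_j F j)` — «hence, for any value attached ADDITIVELY per label, the induced per-label measure is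
UNIFORM: the pair freedom is inert at the LP» (memo §2 F4 (b) «as WEIGHTS it is u again»). (crit-4 `PairLawMarginal.lean`, verbatim) [folklore] -/
theorem pairLaw_additive_value_uniform {G : Type*} [CommGroup G] [Fintype G] (g : G → ℚ) (F : G → ℚ) :
    ∑ i, ∑ j, g (i * j⁻¹) * (F i + F j) = 2 * ((∑ h, g h) * ∑ i, F i) := by
  have h1 : ∀ i : G, ∑ j, g (i * j⁻¹) * F i = (∑ h, g h) * F i := fun i => by
    rw [← Finset.sum_mul, pairLaw_marginal_const g i]
  have h2 : ∀ j : G, ∑ i, g (i * j⁻¹) * F j = (∑ h, g h) * F j := fun j => by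
    rw [← Finset.sum_mul, (pairLaw_marginals_uniform g j).2]
  simp_rw [mul_add, Finset.sum_add_distrib, h1]
  rw [Finset.sum_comm, Finset.sum_congr rfl (fun j _ => h2 j), ← Finset.mul_sum]
  ring

/-- The `G`-SET form (this seat; towards R3 `PairLaw.invariant_iff_differenceClass`, whose orbit–stabiliser half is not keyed): ANY law `π` on ordered pairs of
a finite `G`-set `X` that is invariant under the diagonal action of a PRETRANSITIVE `G` (print: `𝔽_l^{⋊±}` on `T`, [IUTchI] Prop. 6.8 (i); `𝔽_l^⋇` on `J`,
Prop. 4.9 (i); cf. `LabelLaw.SymmetricUnder`, ★ p539557 B2) has both marginals constant — only transitivity is used. [folklore] -/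
theorem invariantPairLaw_marginals_const {G X : Type*} [Group G] [MulAction G X] [Fintype X] [MulAction.IsPretransitive G X] (π : X × X → ℝ)
    (hinv : ∀ (g : G) (s t : X), π (g • s, g • t) = π (s, t)) (s s' : X) :
    ∑ t, π (s, t) = ∑ t, π (s', t) ∧ ∑ t, π (t, s) = ∑ t, π (t, s') := by
  obtain ⟨g, hg⟩ := MulAction.exists_smul_eq G s s'
  rw [← hg]
  refine ⟨?_, ?_⟩
  · calc ∑ t, π (s, t) = ∑ t, π (g • s, g • t) := Finset.sum_congr rfl fun t _ => (hinv g s t).symm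
      _ = ∑ t, π (g • s, t) := (MulAction.bijective g).sum_comp fun t => π (g • s, t)
  · calc ∑ t, π (t, s) = ∑ t, π (g • t, g • s) := Finset.sum_congr rfl fun t _ => (hinv g t s).symm
      _ = ∑ t, π (t, g • s) := (MulAction.bijective g).sum_comp fun t => π (t, g • s)

end PairLaw

/-! ## §D. R4 in TLINEAR's value-law currency — raising the value law lowers the exponent constant -/

/-- **R4 `Estar_antitone_valueLaw`** (memo R4 «`(∀ j, f₁ j ≤ f₂ j) → 1 < E ν f₁ → C ν f₂ ≤ C ν f₁`», read on ★ p545946's `Estar V = 2l·Σ_J pk/(μ₀·S_f(J))`, the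
tree's value-law-parameterised constant): two schemes with the same `pk, J, μ₀, l` and `f₁ ≤ f₂` on `J`, `μ₀ > 0`, `S_{f₁} > 0`, `Σ pk ≥ 0` have `E⋆(V₂) ≤ E⋆(V₁)`
(F1/F7 direction face: more demand per label, smaller constant — and, by `exchangeRate`, no cheaper licence). [folklore] -/
theorem Estar_antitone_valueLaw (V₁ V₂ : Variant) (hpk : V₁.pk = V₂.pk) (hJ : V₁.J = V₂.J) (hμ : V₁.μ₀ = V₂.μ₀) (hl : V₁.l = V₂.l)
    (hf : ∀ j ∈ V₁.J, V₁.f j ≤ V₂.f j) (hμ0 : 0 < V₁.μ₀) (hS : 0 < S V₁) (hC : 0 ≤ countSum V₁) :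
    Estar V₂ ≤ Estar V₁ := by
  have hS2 : S V₁ ≤ S V₂ := by
    unfold S; rw [← hJ]
    exact Finset.sum_le_sum fun j hj => by have h : ((V₁.f j : ℤ) : ℝ) ≤ V₂.f j := (by exact_mod_cast hf j hj); linarith
  have hC2 : countSum V₂ = countSum V₁ := by unfold countSum; rw [hpk, hJ]
  unfold Estar
  rw [hC2, ← hμ, ← hl]
  exact div_le_div_of_nonneg_left (mul_nonneg (mul_nonneg zero_le_two (Nat.cast_nonneg _)) hC) (mul_pos hμ0 hS)
    (mul_le_mul_of_nonneg_left hS2 hμ0.le)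

end Summit.ABC.IUTFork.Repair.RH.R4MeasureExchangeRate

end
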